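import Literature.Analysis.FluidPDE.PassiveScalarShearFibreDamping
import Literature.Analysis.FluidPDE.PassiveScalarWellPosednessProofs
import HarnessLib

/-!
# K1loc, line `Spectral` / SeqCone — helper: PARSEVAL TOOLKIT FOR THE SLOT LEMMA (trigonometric polynomials,
# constant-coefficient first-order operators, the real polynomial `h = Re ∑ w 𝓕F e_k`)

Second S3b helper file of the prover lane on the crux `K1LocalisedCascade` (stmt-AnomalousDissipation-19491), route
`SawtoothPulseCascade` (architecture note `K1loc-architecture-findings-k1locp1.md`, F-b).  The slot lemma tracks the
symbol-weighted energy `Q(t)² = ∑ₖ μ(k)² |𝓕(Ξ·G(t))(k)|²` of the localised Lagrangian pull-back of a classical scalar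
(companion `…SlotPullback`); its time derivative is the pairing `2κ Re ∑ₖ μ² conj(𝓕F) 𝓕(Ξ·(Δθ)∘Φ)`, which is turned
into an `x`-space integral against the REAL TRIGONOMETRIC POLYNOMIAL `h = Re ∑_{k∈S} w(k) 𝓕F(k) e_k` (finite `S`,
weights `w = μ²`).  This file is the line-independent Fourier toolkit for that step, on `T^d = UnitAddTorus d`:

* trigonometric polynomials `T = ∑_{k∈S} a(k) e_k`: smoothness, coefficients, Parseval `∫‖T‖² = ∑‖a‖²`, and the
  pairing `∑_{k∈S} conj(a k) 𝓕g(k) = ∫ conj(T) g` (`sum_conj_mul_mFourierCoeff_eq_integral`);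
* constant-coefficient first-order operators `D_α = ∑_l α_l ∂_l`: `𝓕(D_α g) = 2πi(α·k) 𝓕g` (`mFourierCoeff_dirDeriv`,
  real form `…_ofReal`), Parseval `∫‖D_α T‖² = ∑_{k∈S} 4π²(α·k)²‖a‖²`, Bessel `∑_{k∈S} 4π²(α·k)²‖𝓕F‖² ≤ ∫(D_α F)²`;
* the real polynomial `h`: `∫ h² ≤ ∑_{k∈S}‖a‖²`, `∫ (D_α h)² ≤ ∑_{k∈S} 4π²(α·k)²‖a‖²`, the DISSIPATIVE PAIRING
  `∫ (D_α h)(D_α F) = ∑_{k∈S} 4π²(α·k)² w(k) ‖𝓕F(k)‖²` (`integral_dirDeriv_re_trigPoly_mul_dirDeriv`, `≥ 0` for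
  `w ≥ 0`), and `Re ∑_{k∈S} w conj(𝓕F) 𝓕g = ∫ h g` (`re_sum_mul_conj_mul_mFourierCoeff_eq_integral`).

With `α = eᵢ` and `α = eⱼ − cσ eᵢ` these give the two constant-coefficient pieces `∂ᵢ`, `D̄_σ = ∂ⱼ − cσ∂ᵢ` of the
pulled-back Laplacian on a flat strip of slope `σ` (next file).  WHAT THIS IS NOT: no statement about the cascade
or the stub itself; no definitions.
[cite: Grafakos2014, Prop. 3.1.2 (coefficients of derivatives / translates) and Prop. 3.2.7 (3) (Parseval on `T^d`)]
[cite: BedrossianCotiZelati2017, §2 (k-by-k energy estimates for advection–diffusion by a shear)] [problem: turb]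
-/

-- `Summit.<Summit>.<Problem>`: single-conjunct summit, the duplicate namespace segment is deliberate.
set_option linter.dupNamespace false

noncomputable section

namespace Summit.AnomalousDissipation.AnomalousDissipation.Theorems.SawtoothPulseCascade.K1Slot

open MeasureTheory Set Filter Topology UnitAddTorus Function
open scoped ContDiff InnerProductSpace
open Literature.Analysis Literature.Analysis.FunctionSpaces Literature.Analysis.FunctionSpaces.Torus

-- BODY

open scoped ComplexConjugate

/-! ## §1 Trigonometric polynomials on `T^d`: smoothness, coefficients, Parseval pairings -/

section TrigPoly

variable {d : Type*} [Fintype d] [DecidableEq d]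

omit [DecidableEq d] in
/-- A trigonometric polynomial `∑_{k∈S} a(k) e_k` is smooth. [folklore] -/
theorem isSmooth_trigPoly (S : Finset (d → ℤ)) (a : (d → ℤ) → ℂ) :
    IsSmooth (fun x : UnitAddTorus d => ∑ k ∈ S, a k * mFourier k x) := by
  unfold IsSmooth lift
  simp only [Function.comp_def]
  refine ContDiff.sum fun k _ => contDiff_const.mul ?_
  exact (isSmooth_mFourier (d := d) k)

omit [DecidableEq d] in
/-- Fourier coefficients of a trigonometric polynomial. [cite: Grafakos2014, Prop. 3.2.7 (3)] -/
theorem mFourierCoeff_trigPoly (S : Finset (d → ℤ)) (a : (d → ℤ) → ℂ) (k : d → ℤ) :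
    mFourierCoeff (fun x : UnitAddTorus d => ∑ l ∈ S, a l * mFourier l x) k = if k ∈ S then a k else 0 := by
  classical
  have hint : ∀ l ∈ S, Integrable (fun x : UnitAddTorus d => a l * mFourier l x) volume := fun l _ => by
    have h : IsSmooth (fun x : UnitAddTorus d => a l * mFourier l x) :=
      (isSmooth_const (d := d) (a l)).mul (isSmooth_mFourier l)
    exact h.integrable
  rw [mFourierCoeff_finset_sum S hint]
  have hterm : ∀ l, mFourierCoeff (fun x : UnitAddTorus d => a l * mFourier l x) k = if k = l then a l else 0 := by
    intro l
    have : (fun x : UnitAddTorus d => a l * mFourier l x) = a l • (⇑(mFourier l) : UnitAddTorus d → ℂ) := by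
      funext x; simp [smul_eq_mul]
    rw [this, mFourierCoeff_const_smul, Torus.mFourierCoeff_mFourier, smul_eq_mul, mul_ite, mul_one, mul_zero]
  simp_rw [hterm]
  rw [Finset.sum_ite_eq S k a]

omit [DecidableEq d] in
/-- **Parseval pairing with a trigonometric polynomial**: for continuous `g`,
`∑_{k∈S} conj(a k) 𝓕g(k) = ∫ conj(T) g`, `T = ∑_{k∈S} a(k) e_k`. [cite: Grafakos2014, Prop. 3.2.7 (3)] -/
theorem sum_conj_mul_mFourierCoeff_eq_integral (S : Finset (d → ℤ)) (a : (d → ℤ) → ℂ)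
    {g : UnitAddTorus d → ℂ} (hg : Continuous g) :
    ∑ k ∈ S, conj (a k) * mFourierCoeff g k =
      ∫ x, conj (∑ k ∈ S, a k * mFourier k x) * g x := by
  classical
  have hT := isSmooth_trigPoly S a
  have h := FluidPDE.Torus.hasSum_conj_mFourierCoeff_mul_of_continuous hT.continuous hg
  have hfin : ∀ k ∉ S, conj (mFourierCoeff (fun x : UnitAddTorus d => ∑ l ∈ S, a l * mFourier l x) k) *
      mFourierCoeff g k = 0 := fun k hk => by
    rw [mFourierCoeff_trigPoly, if_neg hk, map_zero, zero_mul]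
  rw [← (hasSum_sum_of_ne_finset_zero hfin).unique h]
  refine Finset.sum_congr rfl fun k hk => ?_
  rw [mFourierCoeff_trigPoly, if_pos hk]

omit [DecidableEq d] in
/-- **Parseval for a trigonometric polynomial**: `∫‖T‖² = ∑_{k∈S} ‖a k‖²`, `T = ∑_{k∈S} a(k) e_k`.
[cite: Grafakos2014, Prop. 3.2.7 (3)] -/
theorem integral_norm_sq_trigPoly (S : Finset (d → ℤ)) (a : (d → ℤ) → ℂ) :
    ∫ x, ‖∑ k ∈ S, a k * mFourier k x‖ ^ 2 = ∑ k ∈ S, ‖a k‖ ^ 2 := by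
  classical
  have hT := isSmooth_trigPoly S a
  have h := hasSum_sq_mFourierCoeff_of_continuous hT.continuous
  have hfin : ∀ k ∉ S, ‖mFourierCoeff (fun x : UnitAddTorus d => ∑ l ∈ S, a l * mFourier l x) k‖ ^ 2 = 0 :=
    fun k hk => by rw [mFourierCoeff_trigPoly, if_neg hk, norm_zero, zero_pow two_ne_zero]
  rw [← (hasSum_sum_of_ne_finset_zero hfin).unique h]
  refine Finset.sum_congr rfl fun k hk => ?_
  rw [mFourierCoeff_trigPoly, if_pos hk]

/-! ### Constant-coefficient first-order operators `D_α = ∑_l α_l ∂_l` on trigonometric polynomials -/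

/-- Smoothness of `D_α g = ∑_l α_l ∂_l g` for smooth complex `g`. [folklore] -/
theorem isSmooth_dirDeriv (α : d → ℝ) {g : UnitAddTorus d → ℂ} (hg : IsSmooth g) :
    IsSmooth (fun x => ∑ l, (α l : ℂ) * partialDeriv l g x) := by
  unfold IsSmooth lift
  simp only [Function.comp_def]
  exact ContDiff.sum fun l _ => contDiff_const.mul (hg.partialDeriv l)

/-- Smoothness of `D_α F = ∑_l α_l ∂_l F` for smooth real `F`. [folklore] -/
theorem isSmooth_dirDeriv_real (α : d → ℝ) {F : UnitAddTorus d → ℝ} (hF : IsSmooth F) :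
    IsSmooth (fun x => ∑ l, α l * partialDeriv l F x) := by
  unfold IsSmooth lift
  simp only [Function.comp_def]
  exact ContDiff.sum fun l _ => contDiff_const.mul (hF.partialDeriv l)

omit [DecidableEq d] in
/-- `∫ Re f = Re ∫ f` for integrable complex `f`. [folklore] -/
theorem integral_re_eq_re_integral {f : UnitAddTorus d → ℂ} (hf : Integrable f volume) :
    ∫ x, (f x).re = (∫ x, f x).re := by
  simpa using Complex.reCLM.integral_comp_comm hf

/-- **Fourier coefficients of `D_α g`**: `𝓕(∑_l α_l ∂_l g)(k) = 2πi (∑_l α_l k_l) 𝓕g(k)` for smooth complex `g`.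
[cite: Grafakos2014, Prop. 3.2.7 (3)] -/
theorem mFourierCoeff_dirDeriv (α : d → ℝ) {g : UnitAddTorus d → ℂ} (hg : IsSmooth g) (k : d → ℤ) :
    mFourierCoeff (fun x => ∑ l, (α l : ℂ) * partialDeriv l g x) k =
      (2 * Real.pi * Complex.I * ((∑ l, α l * (k l : ℝ) : ℝ) : ℂ)) * mFourierCoeff g k := by
  have hint : ∀ l ∈ (Finset.univ : Finset d), Integrable (fun x => (α l : ℂ) * partialDeriv l g x) volume :=
    fun l _ => ((hg.partialDeriv l).integrable).const_mul (α l : ℂ)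
  rw [mFourierCoeff_finset_sum _ hint]
  have hterm : ∀ l, mFourierCoeff (fun x => (α l : ℂ) * partialDeriv l g x) k =
      (α l : ℂ) * ((2 * Real.pi * Complex.I * (k l : ℂ)) * mFourierCoeff g k) := fun l => by
    rw [show (fun x => (α l : ℂ) * partialDeriv l g x) = (α l : ℂ) • partialDeriv l g from rfl,
      mFourierCoeff_const_smul, mFourierCoeff_partialDeriv hg, smul_eq_mul, smul_eq_mul]
  simp_rw [hterm]
  push_cast
  rw [Finset.mul_sum, Finset.sum_mul]
  exact Finset.sum_congr rfl fun l _ => by ring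

/-- The real version: `𝓕(∑_l α_l ∂_l F)(k) = 2πi (α·k) 𝓕F(k)` for smooth real `F` (complexified).
[cite: Grafakos2014, Prop. 3.2.7 (3)] -/
theorem mFourierCoeff_dirDeriv_ofReal (α : d → ℝ) {F : UnitAddTorus d → ℝ} (hF : IsSmooth F) (k : d → ℤ) :
    mFourierCoeff (fun x => ((∑ l, α l * partialDeriv l F x : ℝ) : ℂ)) k =
      (2 * Real.pi * Complex.I * ((∑ l, α l * (k l : ℝ) : ℝ) : ℂ)) * mFourierCoeff (fun x => (F x : ℂ)) k := by
  have hFc : IsSmooth (fun x => (F x : ℂ)) := hF.ofReal_comp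
  rw [← mFourierCoeff_dirDeriv α hFc]
  congr 1
  funext x
  push_cast
  refine Finset.sum_congr rfl fun l _ => ?_
  rw [partialDeriv_ofReal_comp hF]

/-- `‖2πi s‖² = 4π² s²` for real `s`. [folklore] -/
theorem norm_two_pi_I_mul_sq (s : ℝ) : ‖(2 * Real.pi * Complex.I * (s : ℂ))‖ ^ 2 = 4 * Real.pi ^ 2 * s ^ 2 := by
  rw [show (2 * (Real.pi : ℂ) * Complex.I * (s : ℂ)) = (((2 * Real.pi * s : ℝ)) : ℂ) * Complex.I by push_cast; ring,
    norm_mul, Complex.norm_I, mul_one, Complex.norm_real, Real.norm_eq_abs, sq_abs]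
  ring

/-- **Parseval for `D_α T`**, `T` a trigonometric polynomial: `∫‖D_α T‖² = ∑_{k∈S} 4π²(α·k)² ‖a k‖²`.
[cite: Grafakos2014, Prop. 3.2.7 (3)] -/
theorem integral_norm_sq_dirDeriv_trigPoly (α : d → ℝ) (S : Finset (d → ℤ)) (a : (d → ℤ) → ℂ) :
    ∫ x, ‖∑ l, (α l : ℂ) * partialDeriv l (fun x : UnitAddTorus d => ∑ k ∈ S, a k * mFourier k x) x‖ ^ 2 =
      ∑ k ∈ S, 4 * Real.pi ^ 2 * (∑ l, α l * (k l : ℝ)) ^ 2 * ‖a k‖ ^ 2 := by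
  classical
  have hT := isSmooth_trigPoly S a
  have h := hasSum_sq_mFourierCoeff_of_continuous (isSmooth_dirDeriv α hT).continuous
  have hcoef : ∀ k, ‖mFourierCoeff (fun x => ∑ l, (α l : ℂ) *
      partialDeriv l (fun x : UnitAddTorus d => ∑ k ∈ S, a k * mFourier k x) x) k‖ ^ 2 =
      if k ∈ S then 4 * Real.pi ^ 2 * (∑ l, α l * (k l : ℝ)) ^ 2 * ‖a k‖ ^ 2 else 0 := fun k => by
    rw [mFourierCoeff_dirDeriv α hT, mFourierCoeff_trigPoly]
    split_ifs with hk
    · rw [norm_mul, mul_pow, norm_two_pi_I_mul_sq]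
    · simp
  have hfin : ∀ k ∉ S, ‖mFourierCoeff (fun x => ∑ l, (α l : ℂ) *
      partialDeriv l (fun x : UnitAddTorus d => ∑ k ∈ S, a k * mFourier k x) x) k‖ ^ 2 = 0 :=
    fun k hk => by rw [hcoef, if_neg hk]
  rw [← (hasSum_sum_of_ne_finset_zero hfin).unique h]
  exact Finset.sum_congr rfl fun k hk => by rw [hcoef, if_pos hk]

/-- **Bessel for `D_α F`**, `F` smooth real: `∑_{k∈S} 4π²(α·k)² ‖𝓕F(k)‖² ≤ ∫ (D_α F)²`.
[cite: Grafakos2014, Prop. 3.2.7 (3)] -/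
theorem sum_le_integral_dirDeriv_sq (α : d → ℝ) {F : UnitAddTorus d → ℝ} (hF : IsSmooth F)
    (S : Finset (d → ℤ)) :
    ∑ k ∈ S, 4 * Real.pi ^ 2 * (∑ l, α l * (k l : ℝ)) ^ 2 * ‖mFourierCoeff (fun x => (F x : ℂ)) k‖ ^ 2 ≤
      ∫ x, (∑ l, α l * partialDeriv l F x) ^ 2 := by
  have hD : IsSmooth (fun x => ∑ l, α l * partialDeriv l F x) := isSmooth_dirDeriv_real α hF
  have hDc : IsSmooth (fun x => ((∑ l, α l * partialDeriv l F x : ℝ) : ℂ)) := hD.ofReal_comp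
  have h := hasSum_sq_mFourierCoeff_of_continuous hDc.continuous
  have hnorm : ∫ x, ‖((∑ l, α l * partialDeriv l F x : ℝ) : ℂ)‖ ^ 2 = ∫ x, (∑ l, α l * partialDeriv l F x) ^ 2 := by
    refine integral_congr_ae (Eventually.of_forall fun x => ?_)
    simp only [Complex.norm_real, Real.norm_eq_abs, sq_abs]
  rw [← hnorm]
  refine (sum_le_hasSum S (fun k _ => by positivity) h).trans_eq' (Finset.sum_congr rfl fun k _ => ?_)
  rw [mFourierCoeff_dirDeriv_ofReal α hF, norm_mul, mul_pow, norm_two_pi_I_mul_sq]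

/-! ### The real trigonometric polynomial `h = Re ∑_{k∈S} w(k) 𝓕F(k) e_k` attached to a real `F` -/

omit [DecidableEq d] in
/-- `h = Re T` is smooth. [folklore] -/
theorem isSmooth_re_trigPoly (S : Finset (d → ℤ)) (a : (d → ℤ) → ℂ) :
    IsSmooth (fun x : UnitAddTorus d => (∑ k ∈ S, a k * mFourier k x).re) :=
  FluidPDE.Torus.IsSmooth.re (isSmooth_trigPoly S a)

omit [DecidableEq d] in
/-- `∫ h² ≤ ∑_{k∈S} ‖a k‖²` for `h = Re T`. [cite: Grafakos2014, Prop. 3.2.7 (3)] -/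
theorem integral_re_trigPoly_sq_le (S : Finset (d → ℤ)) (a : (d → ℤ) → ℂ) :
    ∫ x, (∑ k ∈ S, a k * mFourier k x).re ^ 2 ≤ ∑ k ∈ S, ‖a k‖ ^ 2 := by
  rw [← integral_norm_sq_trigPoly S a]
  refine integral_mono_of_nonneg (Eventually.of_forall fun x => sq_nonneg _) ?_
    (Eventually.of_forall fun x => ?_)
  · have h : IsSmooth (fun x : UnitAddTorus d => ‖∑ k ∈ S, a k * mFourier k x‖ ^ 2) := by
      have hT := isSmooth_trigPoly S a
      have : (fun x : UnitAddTorus d => ‖∑ k ∈ S, a k * mFourier k x‖ ^ 2) =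
          fun x => (∑ k ∈ S, a k * mFourier k x).re ^ 2 + (∑ k ∈ S, a k * mFourier k x).im ^ 2 := by
        funext x; rw [Complex.sq_norm, Complex.normSq_apply]; ring
      rw [this]
      exact ((FluidPDE.Torus.IsSmooth.re hT).pow 2).add ((hT.comp_clm Complex.imCLM).pow 2)
    exact h.integrable
  · simp only
    rw [Complex.sq_norm, Complex.normSq_apply]
    nlinarith [sq_nonneg (∑ k ∈ S, a k * mFourier k x).im]

/-- `∫ (D_α h)² ≤ ∑_{k∈S} 4π²(α·k)² ‖a k‖²` for `h = Re T`. [cite: Grafakos2014, Prop. 3.2.7 (3)] -/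
theorem integral_dirDeriv_re_trigPoly_sq_le (α : d → ℝ) (S : Finset (d → ℤ)) (a : (d → ℤ) → ℂ) :
    ∫ x, (∑ l, α l * partialDeriv l (fun x : UnitAddTorus d => (∑ k ∈ S, a k * mFourier k x).re) x) ^ 2 ≤
      ∑ k ∈ S, 4 * Real.pi ^ 2 * (∑ l, α l * (k l : ℝ)) ^ 2 * ‖a k‖ ^ 2 := by
  have hT := isSmooth_trigPoly S a
  rw [← integral_norm_sq_dirDeriv_trigPoly α S a]
  -- pointwise: `D_α h = Re (D_α T)`
  have hre : ∀ x, ∑ l, α l * partialDeriv l (fun x : UnitAddTorus d => (∑ k ∈ S, a k * mFourier k x).re) x =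
      (∑ l, (α l : ℂ) * partialDeriv l (fun x : UnitAddTorus d => ∑ k ∈ S, a k * mFourier k x) x).re := by
    intro x
    rw [Complex.re_sum]
    refine Finset.sum_congr rfl fun l _ => ?_
    rw [FluidPDE.Torus.partialDeriv_re hT, Complex.re_ofReal_mul]
  refine integral_mono_of_nonneg (Eventually.of_forall fun x => sq_nonneg _) ?_
    (Eventually.of_forall fun x => ?_)
  · have hD := isSmooth_dirDeriv α hT
    have h : IsSmooth (fun x : UnitAddTorus d => ‖∑ l, (α l : ℂ) *
        partialDeriv l (fun x : UnitAddTorus d => ∑ k ∈ S, a k * mFourier k x) x‖ ^ 2) := by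
      have : (fun x : UnitAddTorus d => ‖∑ l, (α l : ℂ) *
          partialDeriv l (fun x : UnitAddTorus d => ∑ k ∈ S, a k * mFourier k x) x‖ ^ 2) =
          fun x => (∑ l, (α l : ℂ) * partialDeriv l (fun x : UnitAddTorus d => ∑ k ∈ S, a k * mFourier k x) x).re ^ 2
            + (∑ l, (α l : ℂ) * partialDeriv l (fun x : UnitAddTorus d => ∑ k ∈ S, a k * mFourier k x) x).im ^ 2 := by
        funext x; rw [Complex.sq_norm, Complex.normSq_apply]; ring
      rw [this]
      exact ((FluidPDE.Torus.IsSmooth.re hD).pow 2).add ((hD.comp_clm Complex.imCLM).pow 2)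
    exact h.integrable
  · simp only
    rw [hre x, Complex.sq_norm, Complex.normSq_apply]
    nlinarith [sq_nonneg (∑ l, (α l : ℂ) *
      partialDeriv l (fun x : UnitAddTorus d => ∑ k ∈ S, a k * mFourier k x) x).im]

/-- **The dissipative pairing**: for smooth real `F`, weights `w`, `a k = w k · 𝓕F(k)` and `h = Re T`:
`∫ (D_α h)(D_α F) = ∑_{k∈S} 4π²(α·k)² w(k) ‖𝓕F(k)‖²` (in particular `≥ 0` for `w ≥ 0`).
[cite: Grafakos2014, Prop. 3.2.7 (3)] -/
theorem integral_dirDeriv_re_trigPoly_mul_dirDeriv (α : d → ℝ) (S : Finset (d → ℤ)) (w : (d → ℤ) → ℝ)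
    {F : UnitAddTorus d → ℝ} (hF : IsSmooth F) :
    ∫ x, (∑ l, α l * partialDeriv l (fun x : UnitAddTorus d =>
        (∑ k ∈ S, ((w k : ℂ) * mFourierCoeff (fun y => (F y : ℂ)) k) * mFourier k x).re) x) *
        (∑ l, α l * partialDeriv l F x) =
      ∑ k ∈ S, 4 * Real.pi ^ 2 * (∑ l, α l * (k l : ℝ)) ^ 2 * (w k * ‖mFourierCoeff (fun y => (F y : ℂ)) k‖ ^ 2) := by
  classical
  set a : (d → ℤ) → ℂ := fun k => (w k : ℂ) * mFourierCoeff (fun y => (F y : ℂ)) k with ha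
  have hT := isSmooth_trigPoly S a
  have hFc : IsSmooth (fun x => (F x : ℂ)) := hF.ofReal_comp
  have hDT := isSmooth_dirDeriv α hT
  have hDF := isSmooth_dirDeriv α hFc
  -- pointwise: the integrand is `Re (conj (D_α T) · D_α F)`
  have hpt : ∀ x, (∑ l, α l * partialDeriv l (fun x : UnitAddTorus d => (∑ k ∈ S, a k * mFourier k x).re) x) *
      (∑ l, α l * partialDeriv l F x) =
      (conj (∑ l, (α l : ℂ) * partialDeriv l (fun x : UnitAddTorus d => ∑ k ∈ S, a k * mFourier k x) x) *
        (∑ l, (α l : ℂ) * partialDeriv l (fun y => (F y : ℂ)) x)).re := by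
    intro x
    have h1 : ∑ l, α l * partialDeriv l (fun x : UnitAddTorus d => (∑ k ∈ S, a k * mFourier k x).re) x =
        (∑ l, (α l : ℂ) * partialDeriv l (fun x : UnitAddTorus d => ∑ k ∈ S, a k * mFourier k x) x).re := by
      rw [Complex.re_sum]
      refine Finset.sum_congr rfl fun l _ => ?_
      rw [FluidPDE.Torus.partialDeriv_re hT, Complex.re_ofReal_mul]
    have h2 : (∑ l, (α l : ℂ) * partialDeriv l (fun y => (F y : ℂ)) x) = ((∑ l, α l * partialDeriv l F x : ℝ) : ℂ) := by
      push_cast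
      refine Finset.sum_congr rfl fun l _ => ?_
      rw [partialDeriv_ofReal_comp hF]
    rw [h1, h2, Complex.mul_re, Complex.conj_re, Complex.conj_im, Complex.ofReal_re, Complex.ofReal_im]
    ring
  refine (integral_congr_ae (Eventually.of_forall hpt)).trans ?_
  have hint : Integrable (fun x => conj (∑ l, (α l : ℂ) *
      partialDeriv l (fun x : UnitAddTorus d => ∑ k ∈ S, a k * mFourier k x) x) *
        (∑ l, (α l : ℂ) * partialDeriv l (fun y => (F y : ℂ)) x)) volume :=
    ((Complex.continuous_conj.comp hDT.continuous).mul hDF.continuous).integrable_unitAddTorus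
  rw [integral_re_eq_re_integral hint]
  -- Parseval pairing
  have hpar := FluidPDE.Torus.hasSum_conj_mFourierCoeff_mul_of_continuous hDT.continuous hDF.continuous
  have hcoef : ∀ k, conj (mFourierCoeff (fun x => ∑ l, (α l : ℂ) *
      partialDeriv l (fun x : UnitAddTorus d => ∑ k ∈ S, a k * mFourier k x) x) k) *
      mFourierCoeff (fun x => ∑ l, (α l : ℂ) * partialDeriv l (fun y => (F y : ℂ)) x) k =
      if k ∈ S then ((4 * Real.pi ^ 2 * (∑ l, α l * (k l : ℝ)) ^ 2 *
        (w k * ‖mFourierCoeff (fun y => (F y : ℂ)) k‖ ^ 2) : ℝ) : ℂ) else 0 := fun k => by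
    rw [mFourierCoeff_dirDeriv α hT, mFourierCoeff_dirDeriv α hFc, mFourierCoeff_trigPoly]
    split_ifs with hk
    · have e1 : conj (2 * Real.pi * Complex.I * ((∑ l, α l * (k l : ℝ) : ℝ) : ℂ)) *
          (2 * Real.pi * Complex.I * ((∑ l, α l * (k l : ℝ) : ℝ) : ℂ)) =
          ((4 * Real.pi ^ 2 * (∑ l, α l * (k l : ℝ)) ^ 2 : ℝ) : ℂ) := by
        rw [Complex.conj_mul', ← norm_two_pi_I_mul_sq (∑ l, α l * (k l : ℝ))]
        push_cast
        ring
      have e2 : conj (a k) * mFourierCoeff (fun y => (F y : ℂ)) k =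
          ((w k * ‖mFourierCoeff (fun y => (F y : ℂ)) k‖ ^ 2 : ℝ) : ℂ) := by
        simp only [ha, map_mul, Complex.conj_ofReal]
        rw [mul_assoc, Complex.conj_mul']
        push_cast
        ring
      calc conj (2 * Real.pi * Complex.I * ((∑ l, α l * (k l : ℝ) : ℝ) : ℂ) * a k) *
            (2 * Real.pi * Complex.I * ((∑ l, α l * (k l : ℝ) : ℝ) : ℂ) * mFourierCoeff (fun y => (F y : ℂ)) k)
          = (conj (2 * Real.pi * Complex.I * ((∑ l, α l * (k l : ℝ) : ℝ) : ℂ)) *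
              (2 * Real.pi * Complex.I * ((∑ l, α l * (k l : ℝ) : ℝ) : ℂ))) *
              (conj (a k) * mFourierCoeff (fun y => (F y : ℂ)) k) := by rw [map_mul]; ring
        _ = _ := by rw [e1, e2]; push_cast; ring
    · simp
  have hfin : ∀ k ∉ S, conj (mFourierCoeff (fun x => ∑ l, (α l : ℂ) *
      partialDeriv l (fun x : UnitAddTorus d => ∑ k ∈ S, a k * mFourier k x) x) k) *
      mFourierCoeff (fun x => ∑ l, (α l : ℂ) * partialDeriv l (fun y => (F y : ℂ)) x) k = 0 :=
    fun k hk => by rw [hcoef, if_neg hk]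
  rw [← (hasSum_sum_of_ne_finset_zero hfin).unique hpar, Complex.re_sum]
  refine Finset.sum_congr rfl fun k hk => ?_
  rw [hcoef, if_pos hk, Complex.ofReal_re]

omit [DecidableEq d] in
/-- **The pairing is an integral**: for continuous real `g`, weights `w`, `a k = w k 𝓕F(k)`, `h = Re T`:
`Re ∑_{k∈S} w(k) conj(𝓕F(k)) 𝓕g(k) = ∫ h g`. [cite: Grafakos2014, Prop. 3.2.7 (3)] -/
theorem re_sum_mul_conj_mul_mFourierCoeff_eq_integral (S : Finset (d → ℤ)) (w : (d → ℤ) → ℝ)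
    (F : UnitAddTorus d → ℝ) {g : UnitAddTorus d → ℝ} (hg : Continuous g) :
    (∑ k ∈ S, (w k : ℂ) * conj (mFourierCoeff (fun y => (F y : ℂ)) k) * mFourierCoeff (fun y => (g y : ℂ)) k).re =
      ∫ x, (∑ k ∈ S, ((w k : ℂ) * mFourierCoeff (fun y => (F y : ℂ)) k) * mFourier k x).re * g x := by
  classical
  set a : (d → ℤ) → ℂ := fun k => (w k : ℂ) * mFourierCoeff (fun y => (F y : ℂ)) k with ha
  have hgc : Continuous (fun y => (g y : ℂ)) := Complex.continuous_ofReal.comp hg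
  have h := sum_conj_mul_mFourierCoeff_eq_integral S a hgc
  have hsum : ∑ k ∈ S, (w k : ℂ) * conj (mFourierCoeff (fun y => (F y : ℂ)) k) * mFourierCoeff (fun y => (g y : ℂ)) k
      = ∑ k ∈ S, conj (a k) * mFourierCoeff (fun y => (g y : ℂ)) k := by
    refine Finset.sum_congr rfl fun k _ => ?_
    rw [ha]; simp only [map_mul, Complex.conj_ofReal]
  rw [hsum, h]
  have hT := isSmooth_trigPoly S a
  have hint : Integrable (fun x => conj (∑ k ∈ S, a k * mFourier k x) * (g x : ℂ)) volume :=
    ((Complex.continuous_conj.comp hT.continuous).mul hgc).integrable_unitAddTorus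
  rw [← integral_re_eq_re_integral hint]
  refine integral_congr_ae (Eventually.of_forall fun x => ?_)
  simp only [Complex.mul_re, Complex.conj_re, Complex.conj_im, Complex.ofReal_re, Complex.ofReal_im]
  ring

end TrigPoly

end Summit.AnomalousDissipation.AnomalousDissipation.Theorems.SawtoothPulseCascade.K1Slot
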